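import Summits.KontsevichZagierPeriods.KontsevichZagierPeriods.Theses.HermiteRigidity
import Summits.KontsevichZagierPeriods.KontsevichZagierPeriods.Theorems.HermiteRigidityReductionRigidityOfKernelForm
import Summits.KontsevichZagierPeriods.KontsevichZagierPeriods.Theorems.FurushoPentagonSectorToKernelOfLeaves

/-!
# KontsevichZagierPeriods / HermiteRigidity — SPLIT GLUE of the deciding crux `ReductionRigidity`
# (stmt-KontsevichZagierPeriods-3407) through Ayoub's compact presentation (crux-strategist, re-audit r1)

BC2 REDIRECT of the restated target of route `HermiteRigidity`.  The rank-0 target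

  `ReductionRigidity` (REDUCTION + RIGIDITY: `∃ B`, values of `B` linearly independent over the real
  algebraic numbers, every rational representation reduced by moves into the rescaling span `N(B)`)

is kernel-checked equivalent to the summit (`reductionRigidity_iff_kontsevichZagierPeriods`), and the
first strategist split `PadeBoxIslands → IslandComplement → ReductionRigidity` (stmt-15957) has a
summit-equivalent leaf (`IslandComplement`, p117997) glued by one line.  This file proves the NORMAL-FORM
split along the one seam on the hub that is not a sector seam:

* **X₁ = `CubeResolution`** (GEOMETRY INSIDE THE RULES, transcendence-free, Hironaka strength): every
  integral representation `u` of the calculus of `KZCalculus.lean` is congruent modulo `KZ.relations` to a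
  `ℤ`-combination of TAME CUBE classes `[[0,1]ⁿ, f]`, `f` real analytic on a neighbourhood of the closed
  cube (`h1` below, written out import-free; byte-identical up to unfolding with the registered stubs
  `stub_cubeResolution` S1 of crux stmt-10813 `FurushoPentagon.SectorToKernel` and S1b of crux stmt-3929
  `FurushoPentagon.ReducedPeriodRing`; it follows verbatim from the item stmt-3574
  `LiftingCriteria.CubeNashNormalForm` by the landed `cubeResolution_of_cubeNashNormalForm`, and reduces by
  the landed `cubeResolution_of_boundedVolumes` / `cubeNashNormalForm_of_boundedCubeResolution_three` to the
  cube resolution of BOUNDED VOLUMES in ambient dimension `≥ 3`; dimensions `≤ 1` are theorems: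
  `cubeResolution_dimLEOne`, `CubeNashNormalFormDimLeOne.of_mem_of_dim_le_one`);
* **X₂ = `AyoubEffectiveCubeKernel`** (TRANSCENDENCE IN AYOUB'S ALGEBRA, no domains, no semialgebraic
  geometry, no rule (2)): J. Ayoub, Ann. of Math. 181 (2015) Conj. 1.1 = J. Fresán, X-UPS 2024 Conj. 3.5
  at `k = ℚ`: the kernel of `∫_{[0,1]^∞}` on `𝒪_{ℚ-alg}(𝔻̄^∞)` (`AyoubRel.Oan`, `AyoubRel.intC`) is the
  `ℚ`-span of the type-(a) elements `∂G/∂zᵢ − G|_{zᵢ=1} + G|_{zᵢ=0}` (`AyoubRel.relAC i G`) (`h6` below,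
  verbatim the registered stub `stub_ayoubEffectiveCubeKernel` S6 of crux stmt-10813; `⊇` is the tree
  theorem `AyoubRel.intC_relAC_eq_zero`; equivalent to the `ℚ̄`- and all-`k` renderings by
  `AyoubRel.typeAGeneration_forall_iff_rat/…_algebraicClosure`, i.e. to the summit-side conjecture leaf
  `TypeAGenerationConjecture`, which is NOT named here so that no conjecture constant enters the cone).

ASSEMBLY (`ReductionRigidity_of_cubes`, this file): `X₁ → X₂ → ReductionRigidity`.  The seam is the
change of presentation, and it is the opposite of a one-line seam: a formal combination `c` with
`eval c = 0` is (1) resolved into the tame cubical span (X₁) and (2) MERGED to one tame class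
(`ReducedPeriodRing.stub_cubeMerge`, landed p77291), (3) made Ayoub-ADMISSIBLE — one power series of
polyradius `> 1`, algebraic over `ℚ[z]` — inside the moves (`stub_admissibleOfTame`, landed p91241 with its
series / CAD / dyadic-subdivision helpers), (4) its integral is `0` by SOUNDNESS
(`KZ.relations_le_ker_eval_holds`), (5) X₂ gives the REAL STOKES FORM of the padded integrand
(`stub_realStokesForm`, landed p95589: identity theorem, complexify / realify / algebraic transfer), (6) the
primitives are `ℚ`-semialgebraic (`stub_semialgebraicOfAlgebraic`, landed p84536: root selection over a
cylindrical decomposition), (7) padding by dummy variables is a relation and a cube representation whose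
integrand is a sum of Stokes elements along any coordinates is a KZ relation (`stub_stokesSpanCalibration`,
landed p81711) — so `c ∈ KZ.relations`: the KERNEL FORM of Conjecture 1; (8) the kernel form gives
REDUCTION + RIGIDITY by the route's landed glue `reductionRigidityOfKernelForm_proof` (stmt-14406: `B` = a
section of `value` over a maximal real-algebraically independent subfamily of all values).  Steps (1)–(7)
are the landed composition `kzKernel_of_cubeResolution_of_ayoubKernel`
(`Theorems/FurushoPentagonSectorToKernelOfLeaves.lean`, p101326), re-run here step by step so that the glue
item's proof text exhibits the seam; ≈ 3 000 landed lines of transfer lemmas stand behind steps (2)–(7).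

STRENGTH RECORD (honest): in print X₂ is "a reformulation" of the period conjecture (Ayoub 2015, Fait 1.4 —
through Ayoub's motivic `𝒫_KZ`, none of which is in the tree); in the TREE X₂ and the summit are
INCOMPARABLE: `X₂ → KontsevichZagierPeriods` is known only through X₁ (this file / OfLeaves), and
`KontsevichZagierPeriods → X₂` would be a conservativity theorem of the naive H21 move calculus over
Ayoub's Stokes span that exists nowhere (no landed `iff`, no landed implication either way; cheap probes
fail, folder `bc/`).  X₁ is a consequence of the summit only through the value-level cube presentation
(Ayoub 2014 Prop. 11 / Huber–Müller-Stach 2017 Thm. 12.2.1), not in the tree either.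

References: M. Kontsevich, D. Zagier, *Periods* (2001), §1.2; J. Ayoub, Ann. of Math. 181 (2015),
Conj. 1.1, Rem. 1.2, Fait 1.4; J. Ayoub, EMS Newsl. 91 (2014), Def. 9–10, Prop. 11, Rem. 12–13;
J. Fresán, *Une introduction aux périodes*, X-UPS 2024, Conj. 3.5; A. Huber, S. Müller-Stach, *Periods and
Nori Motives* (2017), §12.2, §13.1.
-/

noncomputable section

namespace Summit.KontsevichZagierPeriods.HermiteRigidity.ReductionRigidityOfCubes

open Set MeasureTheory
open Literature.NumberTheory.Transcendental
open Literature.NumberTheory.Transcendental.KZ hiding cubicalSpan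
open Summit.KontsevichZagierPeriods.KontsevichZagierPeriods.Theses.HermiteRigidity (ReductionRigidity)
open Summit.KontsevichZagierPeriods.FurushoPentagon.ReducedPeriodRing (unitCube cubicalGens cubicalSpan
  stub_cubeMerge)
open Summit.KontsevichZagierPeriods.FurushoPentagon.SectorToKernel

/-- **X₁ ∧ X₂ ⇒ the kernel form of Conjecture 1**, step by step along the seam (resolution in the
rules ∣ type-(a) generation in Ayoub's algebra), over the landed transfer stubs S2–S5 of line
`effective-cube-surjection`; the two hypotheses are written out exactly as the children `CubeResolution`,
`AyoubEffectiveCubeKernel` of the split of stmt-KontsevichZagierPeriods-3407 (import-free form of the cube,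
`{x | ∀ i, 0 ≤ x i ∧ x i ≤ 1} = KZ.cube n` definitionally).
-- adapted from Theorems/FurushoPentagonSectorToKernelOfLeaves.lean (`kzKernel_of_cubeResolution_of_ayoubKernel`)
[cite: Ayoub2015, Conj. 1.1] [cite: Ayoub2014, Rem. 12–13] [cite: KontsevichZagier2001, §1.2] -/
theorem kernelForm_of_cubes
    (h1 : ∀ (N : ℕ) (u : Literature.NumberTheory.Transcendental.KZ.IntegralRep N), ∃ c ∈ AddSubgroup.closure {d : Literature.NumberTheory.Transcendental.KZ.FormalRep | ∃ (n : ℕ) (r : Literature.NumberTheory.Transcendental.KZ.IntegralRep n), r.domain = {x : Fin n → ℝ | ∀ i, 0 ≤ x i ∧ x i ≤ 1} ∧ AnalyticOnNhd ℝ r.integrand {x : Fin n → ℝ | ∀ i, 0 ≤ x i ∧ x i ≤ 1} ∧ d = Literature.NumberTheory.Transcendental.KZ.of r}, Literature.NumberTheory.Transcendental.KZ.of u - c ∈ Literature.NumberTheory.Transcendental.KZ.relations)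
    (h6 : ∀ F ∈ Literature.NumberTheory.Transcendental.AyoubRel.Oan (Rat.castHom ℂ), Literature.NumberTheory.Transcendental.AyoubRel.intC F = 0 → F ∈ Literature.NumberTheory.Transcendental.AyoubRel.kSpan (Rat.castHom ℂ) {x : Literature.NumberTheory.Transcendental.AyoubRel.CSeries | ∃ G ∈ Literature.NumberTheory.Transcendental.AyoubRel.Oan (Rat.castHom ℂ), ∃ i : ℕ, x = Literature.NumberTheory.Transcendental.AyoubRel.relAC i G}) :
    ∀ c : FormalRep, eval c = 0 → c ∈ relations := by
  -- the import-free hypothesis `h1` IS the cubical resolution S1 (definitional unfolding of `cubicalSpan`)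
  have h1' : ∀ (N : ℕ) (u : IntegralRep N), ∃ c : FormalRep, c ∈ cubicalSpan ∧ of u - c ∈ relations :=
    fun N u => by
      obtain ⟨c, hc, huc⟩ := h1 N u
      exact ⟨c, hc, huc⟩
  intro c hc
  -- (1) resolution into the tame cubical span and (2) merging to ONE tame cube class `[r]`
  obtain ⟨a, ha, hca⟩ := leaves_cubeNormalForm h1' c
  obtain ⟨n, r, hrd, hra, har⟩ := stub_cubeMerge a ha
  rw [leaves_unitCube_eq_cube] at hrd hra
  -- (3) `[r] ∼ [s]` with `s` Ayoub-admissible (one algebraic power series of polyradius > 1)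
  obtain ⟨s, hsd, hadm, hrs⟩ := stub_admissibleOfTame n r hrd hra
  have hcs : c - of s ∈ relations := by
    have := relations.add_mem (relations.add_mem hca har) hrs
    simpa using this
  -- (4) soundness of the moves: `∫_{[0,1]ⁿ} s = eval c = 0`
  have hs0 : ∫ x in KZ.cube n, s.integrand x = 0 := by
    have h0 : eval (c - of s) = 0 := relations_le_ker_eval_holds hcs
    rw [map_sub, hc, zero_sub, neg_eq_zero, leaves_eval_of_eq_setIntegral_cube s hsd] at h0
    exact h0
  -- (5) type-(a) generation in Ayoub's algebra ⇒ real Stokes form of the padded integrand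
  obtain ⟨d, k, i, H, hH, hid⟩ := stub_realStokesForm h6 n s hsd hadm hs0
  -- (6) the primitives `Hⱼ` are `ℚ`-semialgebraic on the cube (CAD root selection)
  have hHs : ∀ j, AnalyticOnNhd ℝ (H j) (KZ.cube (n + d)) ∧
      IsSemialgebraicFunOn ℚ (KZ.cube (n + d)) (H j) :=
    fun j => ⟨(hH j).1, stub_semialgebraicOfAlgebraic (n + d) (H j) (hH j).1 (hH j).2⟩
  -- (7) pad `s` by `d` dummy variables; a sum of Stokes elements along any coordinates is a relation
  obtain ⟨u, hud, hui⟩ := leaves_exists_oneCube d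
  have htd : (s.prod u).domain = KZ.cube (n + d) := by
    rw [IntegralRep.prod_domain, leaves_prodDomain_eq_cube s u hsd hud]
  have hti : ∀ z ∈ KZ.cube (n + d), (s.prod u).integrand z =
      ∑ j, (fderiv ℝ (H j) z (Pi.single (i j) 1) - H j (Function.update z (i j) 1) +
        H j (Function.update z (i j) 0)) := by
    intro z hz
    rw [leaves_prod_oneCube_integrand s u hui z]
    exact hid z hz
  have ht : of (s.prod u) ∈ relations :=
    stub_stokesSpanCalibration (n + d) (s.prod u) htd k i H hHs hti
  have hst : of s - of (s.prod u) ∈ relations := leaves_of_sub_of_prod_oneCube s u hud hui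
  have hsplit : c = (c - of s) + (of s - of (s.prod u)) + of (s.prod u) := by abel
  rw [hsplit]
  exact relations.add_mem (relations.add_mem hcs hst) ht

/-- **SPLIT GLUE** of the rank-0 target of route `HermiteRigidity` (crux-strategist re-audit r1 of
stmt-KontsevichZagierPeriods-3407): `CubeResolution → AyoubEffectiveCubeKernel → ReductionRigidity`, the
two antecedents written out exactly as the split's children.  (1)–(7): the kernel form of Conjecture 1
from the two leaves (`kernelForm_of_cubes`); (8): REDUCTION + RIGIDITY from the kernel form by the landed
route glue `reductionRigidityOfKernelForm_proof` (stmt-KontsevichZagierPeriods-14406).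
[cite: KontsevichZagier2001, §1.2] [cite: Ayoub2015, Conj. 1.1] [cite: HuberMullerStachPeriods2017, §13.1] -/
theorem ReductionRigidity_of_cubes :
    (∀ (N : ℕ) (u : Literature.NumberTheory.Transcendental.KZ.IntegralRep N), ∃ c ∈ AddSubgroup.closure {d : Literature.NumberTheory.Transcendental.KZ.FormalRep | ∃ (n : ℕ) (r : Literature.NumberTheory.Transcendental.KZ.IntegralRep n), r.domain = {x : Fin n → ℝ | ∀ i, 0 ≤ x i ∧ x i ≤ 1} ∧ AnalyticOnNhd ℝ r.integrand {x : Fin n → ℝ | ∀ i, 0 ≤ x i ∧ x i ≤ 1} ∧ d = Literature.NumberTheory.Transcendental.KZ.of r}, Literature.NumberTheory.Transcendental.KZ.of u - c ∈ Literature.NumberTheory.Transcendental.KZ.relations) → (∀ F ∈ Literature.NumberTheory.Transcendental.AyoubRel.Oan (Rat.castHom ℂ), Literature.NumberTheory.Transcendental.AyoubRel.intC F = 0 → F ∈ Literature.NumberTheory.Transcendental.AyoubRel.kSpan (Rat.castHom ℂ) {x : Literature.NumberTheory.Transcendental.AyoubRel.CSeries | ∃ G ∈ Literature.NumberTheory.Transcendental.AyoubRel.Oan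 (Rat.castHom ℂ), ∃ i : ℕ, x = Literature.NumberTheory.Transcendental.AyoubRel.relAC i G}) → ReductionRigidity :=
  fun h1 h6 =>
    (id Summit.KontsevichZagierPeriods.HermiteRigidity.ReductionRigidityOfKernelForm.reductionRigidityOfKernelForm_proof :
      (∀ c : FormalRep, eval c = 0 → c ∈ relations) → ReductionRigidity) (kernelForm_of_cubes h1 h6)

/-- The same glue composed with the landed OfLeaves composition in one step (cross-check that the
import-free children are definitionally the hypotheses of
`kzKernel_of_cubeResolution_of_ayoubKernel`). [cite: Ayoub2015, Conj. 1.1] [folklore] -/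
theorem ReductionRigidity_of_cubes' :
    (∀ (N : ℕ) (u : Literature.NumberTheory.Transcendental.KZ.IntegralRep N), ∃ c ∈ AddSubgroup.closure {d : Literature.NumberTheory.Transcendental.KZ.FormalRep | ∃ (n : ℕ) (r : Literature.NumberTheory.Transcendental.KZ.IntegralRep n), r.domain = {x : Fin n → ℝ | ∀ i, 0 ≤ x i ∧ x i ≤ 1} ∧ AnalyticOnNhd ℝ r.integrand {x : Fin n → ℝ | ∀ i, 0 ≤ x i ∧ x i ≤ 1} ∧ d = Literature.NumberTheory.Transcendental.KZ.of r}, Literature.NumberTheory.Transcendental.KZ.of u - c ∈ Literature.NumberTheory.Transcendental.KZ.relations) → (∀ F ∈ Literature.NumberTheory.Transcendental.AyoubRel.Oan (Rat.castHom ℂ), Literature.NumberTheory.Transcendental.AyoubRel.intC F = 0 → F ∈ Literature.NumberTheory.Transcendental.AyoubRel.kSpan (Rat.castHom ℂ) {x : Literature.NumberTheory.Transcendental.AyoubRel.CSeries | ∃ G ∈ Literature.NumberTheory.Transcendental.AyoubRel.Oan (Rat.castHom ℂ), ∃ i : ℕ, x = Literature.NumberTheory.Transcendental.AyoubRel.relAC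 i G}) → ReductionRigidity :=
  fun h1 h6 =>
    (id Summit.KontsevichZagierPeriods.HermiteRigidity.ReductionRigidityOfKernelForm.reductionRigidityOfKernelForm_proof :
      (∀ c : FormalRep, eval c = 0 → c ∈ relations) → ReductionRigidity)
      (kzKernel_of_cubeResolution_of_ayoubKernel (fun N u => by
        obtain ⟨c, hc, huc⟩ := h1 N u
        exact ⟨c, hc, huc⟩) h6)

/-- **The summit from the two leaves, through this route**: `CubeResolution → AyoubEffectiveCubeKernel →
KontsevichZagierPeriods` = the split glue followed by the route's deciding theorem `closes` with the
landed `RigidKernel` (stmt-10633). [cite: KontsevichZagier2001, §1.2] [folklore] -/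
theorem kontsevichZagierPeriods_of_cubes
    (h1 : ∀ (N : ℕ) (u : Literature.NumberTheory.Transcendental.KZ.IntegralRep N), ∃ c ∈ AddSubgroup.closure {d : Literature.NumberTheory.Transcendental.KZ.FormalRep | ∃ (n : ℕ) (r : Literature.NumberTheory.Transcendental.KZ.IntegralRep n), r.domain = {x : Fin n → ℝ | ∀ i, 0 ≤ x i ∧ x i ≤ 1} ∧ AnalyticOnNhd ℝ r.integrand {x : Fin n → ℝ | ∀ i, 0 ≤ x i ∧ x i ≤ 1} ∧ d = Literature.NumberTheory.Transcendental.KZ.of r}, Literature.NumberTheory.Transcendental.KZ.of u - c ∈ Literature.NumberTheory.Transcendental.KZ.relations)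
    (h6 : ∀ F ∈ Literature.NumberTheory.Transcendental.AyoubRel.Oan (Rat.castHom ℂ), Literature.NumberTheory.Transcendental.AyoubRel.intC F = 0 → F ∈ Literature.NumberTheory.Transcendental.AyoubRel.kSpan (Rat.castHom ℂ) {x : Literature.NumberTheory.Transcendental.AyoubRel.CSeries | ∃ G ∈ Literature.NumberTheory.Transcendental.AyoubRel.Oan (Rat.castHom ℂ), ∃ i : ℕ, x = Literature.NumberTheory.Transcendental.AyoubRel.relAC i G}) :
    _root_.KontsevichZagierPeriods :=
  KontsevichZagierPeriods_iff.mpr (kzKernelConjecture_iff_isRational.mp (kernelForm_of_cubes h1 h6))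

end Summit.KontsevichZagierPeriods.HermiteRigidity.ReductionRigidityOfCubes
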